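import Summits.BirchSwinnertonDyer.BirchSwinnertonDyer.Theorems.KatoDescentTamePotSupersingularCartanMuRoadDoorsTprimeFive
import Summits.BirchSwinnertonDyer.BirchSwinnertonDyer.Theorems.KatoDescentTamePotSupersingularTameUpperUnitTwistRecordTools
import Summits.BirchSwinnertonDyer.BirchSwinnertonDyer.Theorems.KatoDescentTamePotSupersingularTameUpperUnitTwistRecordToolsTprime
import Summits.BirchSwinnertonDyer.BirchSwinnertonDyer.Theorems.Rank1ResidualIntModelReduction
import Summits.BirchSwinnertonDyer.Rank1Residual.Supersingular.CountPointsFast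
import Summits.BirchSwinnertonDyer.Rank1Residual.Supersingular.IntModelMinimalityKrausTwoMore
import Summits.BirchSwinnertonDyer.Rank1Residual.Additive.X4ThreeResCertKernel
import Summits.BirchSwinnertonDyer.Rank1Residual.X11b.CertificateCheckBridge
import Summits.BirchSwinnertonDyer.Rank1Residual.X11b.ChaPairsMinimality
import HarnessLib

/-!
# Route `KatoDescentTamePotSupersingular` (rung K8, sub-rung B4 (t′), cell `bsd-potss`): per-row (A) and U₀ RECORDS BY THE μ-ROAD at `p = 5`
# for the U₀-ns rows with SPLIT-Cartan-normaliser image and NO unit-twist record, part 01: 283200dw1, 283200gf1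
# (seat `bsd-potss-k8t-c4` g17; door `CartanMuRoadDoorsTprimeFive.missingUpperBoundAt_five_tame_of_splitCartanBasis_of_mu` (§3) over
# conjA-anchor g11's road R2–R5; `--supports stmt-BirchSwinnertonDyer-19982 --as helper`)

HONEST FRAMING. THEOREMS ONLY (no definition, no named fact, no `sorry`); PER ROW — NOT a class theorem; nothing is booked; items 19916 /
19202 / 19982 stay OPEN at class level (class-wide open inputs: the zeta crux 24439 and the lower half of the residual 19984); (A), Conjecture A
and BSD are proved for NO curve here. ROAD: `MissingUpperBoundAt E 5 ⟸` NAMED FACTS Kato's fine-Selmer reading of 14.5 (3) (`hKatoA`), GZK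
(`hGZK`), modularity (`hmod`), Coates–Sujatha Thm. 3.4 (`hCS`), Ferrero–Washington (`hFW`) `+` Cremona's `r_an = 0` (`hr`, displayed) `+`
KERNEL (this file) `Δ ≠ 0`, minimality, `Addv E 5`, `ord₅ j ≥ 0`, `SubTprime E 5`, `E[5]` irreducible `+` the DISPLAYED split-Cartan basis
data (`e`, `he`, `σ_u σ_v σ_w` acting as `diag(2,1)`, `diag(1,2)`, `(0 1;1 0)` — the image type `5Ns` is the census's / LMFDB's, displayed
not certified; the kernel has `ρ̄₅` not onto for such rows via Zywina's `J₉` line only where a `…RecordsImageFive*` file exists) `+` FOUR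
`μ`-hypotheses (`ℚ(P₁)` 8, `ℚ(E[5])^⟨σ̄_u²σ̄_v⟩` 8, `ℚ(xP₁)` 4, `ℚ(⟨P₁+P₂⟩)` 4) whose NUMERICAL verdicts — kit j309300 with conjA-anchor g12's
engine `unitidx.gp` v2.1 (sha16 0eb8f6c644f9c1fa; the `N_s(5)` roles `u = diag(2,1)`, `v = diag(1,2)`, `w` = swap of g11's road), every
leaf `PASS:IW56` (one prime above 5, `5 ∤ h`, class number CERTIFIED) — are quoted per row. These rows (283200dw1, 283200gf1, 434400l1) were
left without a record by the unit-twist censuses v3–v13 (`ellrank`-exhausted on every Heegner twist with `N·d² ≤ 1.2·10¹⁴`, or — 283200gf1,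
the `p = 5` Conj-A residue row with two Tamagawa carriers — outside both unit-twist roads); the fourth such row 446400hu1 has a mod-5 image
of order 16 (index 2 in `N_s(5)`), outside road R5's basis shape, and is not recorded here.

References: [Kato2004Asterisque] Thm. 12.5 (3), 14.5 (3); [CoatesSujatha2005] Thm. 3.4; [Washington1997] §7.5, §13.1; [Iwasawa1956];
[Serre1972] §2.2; [Mazur1978] §6; [IrelandRosen1990] §5, §8; [SilvermanAEC2009] VII; [Kraus1989]; [Cremona2006] Table 1.
-/

set_option autoImplicit false
set_option linter.dupNamespace false

noncomputable section

open scoped Classical NumberField Matrix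
open WeierstrassCurve Field IntermediateField
  Literature.NumberTheory.EllipticCurves Literature.NumberTheory.EllipticCurves.Rank1Residual
  Literature.NumberTheory.EllipticCurves.Rank1Residual.Typed
  Literature.NumberTheory.EllipticCurves.Rank1Residual.X11RankOneCertificates
  Literature.NumberTheory.GaloisRepresentations Literature.NumberTheory.SerreUniformity
  Literature.NumberTheory.IwasawaTheory
  Summit.BirchSwinnertonDyer.BirchSwinnertonDyer.Rank1Residual.IntModel
  Summit.BirchSwinnertonDyer.Rank1Residual Summit.BirchSwinnertonDyer.Rank1Residual.Additive
  Summit.BirchSwinnertonDyer.Rank1Residual.Supersingular Summit.BirchSwinnertonDyer.Rank1Residual.X11b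
  Summit.BirchSwinnertonDyer.BirchSwinnertonDyer.Theorems

namespace Summit.BirchSwinnertonDyer.BirchSwinnertonDyer.Theorems.TameConjAFiveRecords

/-! ### `283200dw1` @ `p = 5` — `N = 283200 = 2^6·3·5^2·59`; Cremona: `r_an = 0`; (t′) at `5`: `e = 3` (Kodaira IV or IV*);
mod-`5` image the normaliser of a SPLIT Cartan `N_s(5)` (LMFDB `5Ns`; #G 32 N_s(5)-type: v order 4 with L^<v> ~ Q(P), z central of order 4, u = z v^-1 = w v w^-1 (w involution) checked); ♭ row (`5 ∤ ∏ c_ℓ`); no unit-twist record through census v13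
(`ellrank`-exhausted; kernel lemmas in THIS file). Leaf census (kit j309300, conjA-anchor g12 engine `unitidx.gp` v2.1 sha16 0eb8f6c644f9c1fa with
the `N_s(5)` roles of g11's road R5; class numbers CERTIFIED by `bnfcertify`): P<v> deg 8 `x^8 + 20*x^4 - 40*x^2 + 20` h = 4 (CERT) primes above 5 [[8, 1]] ⇒ PASS:IW56; Dq<u^2 v> deg 8 `x^8 + 20*x^4 + 40*x^2 + 20` h = 4 (CERT) primes above 5 [[8, 1]] ⇒ PASS:IW56; X<u^2,v> deg 4 `x^4 - 2*x^3 + 4*x^2 + 2*x + 1` h = 4 (CERT) primes above 5 [[4, 1]] ⇒ PASS:IW56; C<uv,w> deg 4 `x^4 - x^2 - 1` h = 1 (CERT) primes above 5 [[2, 2]] ⇒ PASS:IW56 ⇒ `CHAIN:PASS` — every leaf by Iwasawa 1956 (one prime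
above 5, `5 ∤ h`; a tree theorem). -/

/-- `[0, (-1), 0, 194792, 94585162]` (Cremona's minimal model of `283200dw1`, `N = 283200 = 2^6·3·5^2·59`) is an elliptic curve: `|Δ| = 2^6·3^5·5^8·59^5 ≠ 0`. [cite: Cremona2006, Table 1 (Cremona label 283200dw1)] -/
theorem isElliptic_g283200dw1 : (⟨0, (-1), 0, 194792, 94585162⟩ : WeierstrassCurve ℚ).IsElliptic :=
  isElliptic_of_discOf_ne_zero 0 (-1) 0 194792 94585162 (by decide +kernel)

/-- `[0, (-1), 0, 194792, 94585162]` (Cremona's minimal model of `283200dw1`) is globally minimal: `|Δ| = 2^6·3^5·5^8·59^5` kernel-checked, Kraus' criterion prime by prime.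
[cite: SilvermanAEC2009, VII.1 Remark 1.1] [cite: Kraus1989, Prop. 1 and Prop. 2] [cite: Cremona2006, Table 1 (Cremona label 283200dw1)] -/
theorem isGloballyMinimal_g283200dw1 : (⟨0, (-1), 0, 194792, 94585162⟩ : WeierstrassCurve ℚ).IsGloballyMinimal :=
  isGloballyMinimal_of_krausCriterion₃_factored 0 (-1) 0 194792 94585162
    [(2, 6), (3, 5), (5, 8), (59, 5)] (by decide +kernel)
    (by intro qe hqe; simp only [List.mem_cons, List.not_mem_nil, or_false] at hqe
        rcases hqe with rfl | rfl | rfl | rfl <;> norm_num)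
    (by set_option synthInstance.maxSize 2000 in decide +kernel)

/-- **`E[5]` IRREDUCIBLE for `E = 283200dw1`** (kernel; Frobenius witness `ℓ = 13`: `#Ẽ(𝔽_{13}) = 14`, `a_{13} = 0`, `X² − (0)X + 13`
has no root mod `5`; `IntModel.hasIrreducibleModPGaloisRep_of_intModel_of_noroot`). [cite: Mazur1978, §6 Prop. 6.3 (1) (p. 153)]
[cite: IrelandRosen1990, Prop. 5.1.2 and §8.1] [cite: Cremona2006, Table 1 (Cremona label 283200dw1)] -/
theorem irr_g283200dw1_5 : haveI : Fact (Nat.Prime 5) := ⟨by norm_num⟩; (⟨0, (-1), 0, 194792, 94585162⟩ : WeierstrassCurve ℚ).HasIrreducibleModPGaloisRep 5 := by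
  have hnr : ∀ t : ZMod 5, t ^ 2 - ((((13 : ℕ) : ℤ) + 1 - ((14 : ℕ) : ℤ) : ℤ) : ZMod 5) * t + ((13 : ℕ) : ZMod 5) ≠ 0 := by
    decide
  haveI := isElliptic_g283200dw1
  haveI := isGloballyMinimal_g283200dw1
  haveI : Fact (Nat.Prime 5) := ⟨by norm_num⟩
  haveI : Fact (Nat.Prime 13) := ⟨by norm_num⟩
  have hI : integralModelInt (⟨0, (-1), 0, 194792, 94585162⟩ : WeierstrassCurve ℚ) = (⟨0, (-1), 0, 194792, 94585162⟩ : WeierstrassCurve ℤ) :=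
    integralModelInt_eq_of_map_eq _ (map_mk_int 0 (-1) 0 194792 94585162)
  have hc : Nat.card (((((⟨0, (-1), 0, 194792, 94585162⟩ : WeierstrassCurve ℤ))).map (Int.castRingHom (ZMod 13))).toAffine.Point) = 14 := by
    have h := natCard_point_eq_countPoints 0 (-1) 0 194792 94585162 13 (by norm_num) (by decide +kernel)
    have h' : countPoints [0, (-1), 0, 194792, 94585162] 13 = 14 := countPoints_eq_of_fast (by decide +kernel)
    exact_mod_cast h.trans h'
  exact hasIrreducibleModPGaloisRep_of_intModel_of_noroot hI 5 13 (by norm_num) (by decide +kernel) hc hnr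

/-- **`283200dw1` is ADDITIVE at `5`** (kernel: `5 ∣ Δ`, `5 ∣ c₄` on the minimal model; `Additive.addv_of_intModel`).
[cite: SilvermanAEC2009, VII.5 Prop. 5.1 (c)] [cite: Cremona2006, Table 1 (Cremona label 283200dw1)] -/
theorem addv_g283200dw1_5 : haveI := isElliptic_g283200dw1; haveI := isGloballyMinimal_g283200dw1; haveI : Fact (Nat.Prime 5) := ⟨by norm_num⟩; Addv (⟨0, (-1), 0, 194792, 94585162⟩ : WeierstrassCurve ℚ) 5 := by
  haveI := isElliptic_g283200dw1
  haveI := isGloballyMinimal_g283200dw1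
  haveI : Fact (Nat.Prime 5) := ⟨by norm_num⟩
  have hI : integralModelInt (⟨0, (-1), 0, 194792, 94585162⟩ : WeierstrassCurve ℚ) = (⟨0, (-1), 0, 194792, 94585162⟩ : WeierstrassCurve ℤ) :=
    integralModelInt_eq_of_map_eq _ (map_mk_int 0 (-1) 0 194792 94585162)
  exact Additive.addv_of_intModel hI 5 (by decide +kernel) (by decide +kernel)

/-- **`ord_5 j(E) ≥ 0` for `E = 283200dw1`** (kernel: `5^5 ∣ c₄`, `5^9 ∤ Δ`, `8 ≤ 3·5` on the minimal model;
`padicValRat_j_nonneg_of_intModel`) — potentially good reduction at `5`. [cite: SilvermanAEC2009, VII.5 Prop. 5.5] [cite: Cremona2006, Table 1 (Cremona label 283200dw1)] -/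
theorem jint_g283200dw1_5 : haveI := isElliptic_g283200dw1; 0 ≤ padicValRat 5 (⟨0, (-1), 0, 194792, 94585162⟩ : WeierstrassCurve ℚ).j := by
  haveI := isElliptic_g283200dw1
  haveI := isGloballyMinimal_g283200dw1
  haveI : Fact (Nat.Prime 5) := ⟨by norm_num⟩
  have hI : integralModelInt (⟨0, (-1), 0, 194792, 94585162⟩ : WeierstrassCurve ℚ) = (⟨0, (-1), 0, 194792, 94585162⟩ : WeierstrassCurve ℤ) :=
    integralModelInt_eq_of_map_eq _ (map_mk_int 0 (-1) 0 194792 94585162)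
  exact TameUpperUnitTwistRecords.padicValRat_j_nonneg_of_intModel hI 5 (a := 5) (b := 8) (by decide +kernel) (by decide +kernel) (by norm_num)

/-- **`283200dw1` lies on the census cell (t′) at `p = 5`** (kernel: `SubTprime` = not potentially multiplicative (`jint_g283200dw1_5`),
`f_5 = 2` (automatic at an additive `p ≥ 5`), semistability index `e = 12/gcd(12, ord_5 Δ) = 12/gcd(12,8) = 3 ∤ 5 − 1`;
`subTprime_of_intModel`). [cite: SilvermanATAEC1994, IV.10.4] [cite: Delbourgo1998, §1.5] [cite: Cremona2006, Table 1 (Cremona label 283200dw1)] -/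
theorem subTprime_g283200dw1_5 : haveI := isElliptic_g283200dw1; haveI := isGloballyMinimal_g283200dw1; haveI : Fact (Nat.Prime 5) := ⟨by norm_num⟩; SubTprime (⟨0, (-1), 0, 194792, 94585162⟩ : WeierstrassCurve ℚ) 5 := by
  haveI := isElliptic_g283200dw1
  haveI := isGloballyMinimal_g283200dw1
  haveI : Fact (Nat.Prime 5) := ⟨by norm_num⟩
  have hI : integralModelInt (⟨0, (-1), 0, 194792, 94585162⟩ : WeierstrassCurve ℚ) = (⟨0, (-1), 0, 194792, 94585162⟩ : WeierstrassCurve ℤ) :=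
    integralModelInt_eq_of_map_eq _ (map_mk_int 0 (-1) 0 194792 94585162)
  exact TameUpperUnitTwistRecords.subTprime_of_intModel hI 5 (by norm_num) addv_g283200dw1_5 jint_g283200dw1_5 (b := 8) (by decide +kernel) (by decide +kernel)
    (by decide)

/-- **(A) at `(283200dw1, 5)` — the conclusion of `TameCoatesSujathaResidue` (19916) AT THIS ROW**, by conjA-anchor g11's split-Cartan road
R2–R5 (`CoatesSujatha2005.fineSelmerDual_moduleFinite_of_splitCartanBasis_five`, p624652): for every cyclotomic `ℤ_5`-extension `κ` of `ℚ`, the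
dual fine Selmer group of `E` over `ℚ_cyc` is finitely generated over `ℤ_5`, from the NAMED FACTS `hCS` (Coates–Sujatha Thm. 3.4) and `hFW`
(Ferrero–Washington), the DISPLAYED split-Cartan basis data (`e`, `he`, `σ_u ↦ diag(2,1)`, `σ_v ↦ diag(1,2)`, `σ_w ↦ (0 1;1 0)`) and `μ = 0` for
the cyclotomic `ℤ_5`-extension of the FOUR fixed fields `ℚ(P₁)` (8), `ℚ(E[5])^⟨σ̄_u²σ̄_v⟩` (8), `ℚ(x P₁)` (4), `ℚ(⟨P₁+P₂⟩)` (4)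
(`hμP hμD hμX hμC`; numerically the leaves `P<v>`, `Dq<u^2 v>`, `X<u^2,v>`, `C<uv,w>` of the section header, all `PASS:IW56`, certified).
CONDITIONAL record; (A) is asserted for no curve; nothing booked. [cite: CoatesSujatha2005, Thm. 3.4 (§3)] [cite: Washington1997, §7.5, §13.1]
[cite: Serre1972, §2.2] [cite: Lemmermeyer1994, §1] [cite: Cremona2006, Table 1 (Cremona label 283200dw1)] -/
theorem conjA_g283200dw1_5
    (hCS : CoatesSujatha2005.thm34_fineSelmerDual_moduleFinite_of_classicalMuVanishes_divisionField)
    (hFW : ferreroWashington1979_classicalMuVanishes)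
    {W : WeierstrassCurve ℚ} [W.IsElliptic] (hWeq : W = (⟨0, (-1), 0, 194792, 94585162⟩ : WeierstrassCurve ℚ))
    (e : W.geomTorsion (5 : ℕ) ≃+ (Fin 2 → ZMod 5))
    (he : ∀ σ : absoluteGaloisGroup ℚ, ∃ M ∈ splitCartanNormalizer 5, ∀ P : W.geomTorsion (5 : ℕ), e (σ • P) = M *ᵥ e P)
    (σu σv σw : absoluteGaloisGroup ℚ) (hσu : ∀ P : W.geomTorsion (5 : ℕ), e (σu • P) = !![2, 0; 0, 1] *ᵥ e P)
    (hσv : ∀ P : W.geomTorsion (5 : ℕ), e (σv • P) = !![1, 0; 0, 2] *ᵥ e P)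
    (hσw : ∀ P : W.geomTorsion (5 : ℕ), e (σw • P) = !![0, 1; 1, 0] *ᵥ e P)
    (hμP : ∀ κE : ZpExtension ↥(fixedField (Subgroup.zpowers (absRestrictNormalHom (W.divisionField 5) σv))) 5,
      κE.IsCyclotomic → ClassicalMuVanishes κE)
    (hμD : ∀ κE : ZpExtension ↥(fixedField (Subgroup.zpowers (absRestrictNormalHom (W.divisionField 5) σu *
        absRestrictNormalHom (W.divisionField 5) σu * absRestrictNormalHom (W.divisionField 5) σv))) 5,
      κE.IsCyclotomic → ClassicalMuVanishes κE)
    (hμX : ∀ κE : ZpExtension ↥(fixedField (Subgroup.zpowers (absRestrictNormalHom (W.divisionField 5) σu *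
        absRestrictNormalHom (W.divisionField 5) σu) ⊔ Subgroup.zpowers (absRestrictNormalHom (W.divisionField 5) σv))) 5,
      κE.IsCyclotomic → ClassicalMuVanishes κE)
    (hμC : ∀ κE : ZpExtension ↥(fixedField (Subgroup.zpowers (absRestrictNormalHom (W.divisionField 5) σu *
        absRestrictNormalHom (W.divisionField 5) σv) ⊔ Subgroup.zpowers (absRestrictNormalHom (W.divisionField 5) σw))) 5,
      κE.IsCyclotomic → ClassicalMuVanishes κE)
    (κ : ZpExtension ℚ 5) (hκ : κ.IsCyclotomic) :
    ∃ (γ : absoluteGaloisGroup ℚ) (Df : W.FineSelmerDualData κ γ),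
      Module.Finite ℤ_[5] (RestrictScalars ℤ_[5] (IwasawaAlgebra 5) Df.X) := by
  subst hWeq
  haveI : Fact (Nat.Prime 5) := ⟨by norm_num⟩
  exact CoatesSujatha2005.fineSelmerDual_moduleFinite_of_splitCartanBasis_five hCS hFW _ e he σu σv σw hσu hσv hσw hμP hμD hμX hμC κ hκ

/-- **RECORD — UPPER half `ord₅ #Ш(E) ≤ ord₅ #Ш(E)_an` for `E = 283200dw1` at `p = 5` BY THE μ-ROAD** (U₀-ns row of KT items 19202 /
19982; the FIRST U₀ record of this row (no unit twist certified through census v13)): the (t′) door `CartanMuRoadDoorsTprimeFive.missingUpperBoundAt_five_tame_of_splitCartanBasis_of_mu` (fine-Selmer port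
of Kato 14.5 (3) ∘ (A) from the four `μ`-hypotheses). KERNEL (this file): `Δ ≠ 0`, global minimality (Kraus), `E[5]` irreducible (Frobenius
witness), `Addv E 5`, `ord₅ j ≥ 0`, `SubTprime E 5`. DISPLAYED: the named facts `hKatoA hGZK hmod hCS hFW`; Cremona's `r_an = 0` (`hr`); the
split-Cartan basis data and the four `μ`-hypotheses of `conjA_g283200dw1_5`. Per row; CONDITIONAL; nothing booked; BSD is not proved by this.
[cite: Kato2004Asterisque, Thm. 14.5 (3) (p. 236), Thm. 12.5 (3) (p. 222)] [cite: CoatesSujatha2005, Thm. 3.4 (§3)] [cite: Washington1997, §13.1]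
[cite: Miller2011LMS, Def. 1.1] [cite: Cremona2006, Table 1 (Cremona label 283200dw1)] -/
theorem missingUpperBoundAt_g283200dw1_5
    (hKatoA : Kato2004.rankZero_padicValNat_sha_add_padicValNat_tamagawa_le_of_additive_potGood_of_irreducible_of_fineSelmerDual_fg)
    (hGZK : rank_eq_analyticRank_of_analyticRank_le_one) (hmod : hasEntireLFunction_rat)
    (hCS : CoatesSujatha2005.thm34_fineSelmerDual_moduleFinite_of_classicalMuVanishes_divisionField)
    (hFW : ferreroWashington1979_classicalMuVanishes)
    {W : WeierstrassCurve ℚ} [W.IsElliptic] [W.IsGloballyMinimal] (hWeq : W = (⟨0, (-1), 0, 194792, 94585162⟩ : WeierstrassCurve ℚ)) (hr : W.analyticRank = 0)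
    (e : W.geomTorsion (5 : ℕ) ≃+ (Fin 2 → ZMod 5))
    (he : ∀ σ : absoluteGaloisGroup ℚ, ∃ M ∈ splitCartanNormalizer 5, ∀ P : W.geomTorsion (5 : ℕ), e (σ • P) = M *ᵥ e P)
    (σu σv σw : absoluteGaloisGroup ℚ) (hσu : ∀ P : W.geomTorsion (5 : ℕ), e (σu • P) = !![2, 0; 0, 1] *ᵥ e P)
    (hσv : ∀ P : W.geomTorsion (5 : ℕ), e (σv • P) = !![1, 0; 0, 2] *ᵥ e P)
    (hσw : ∀ P : W.geomTorsion (5 : ℕ), e (σw • P) = !![0, 1; 1, 0] *ᵥ e P)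
    (hμP : ∀ κE : ZpExtension ↥(fixedField (Subgroup.zpowers (absRestrictNormalHom (W.divisionField 5) σv))) 5,
      κE.IsCyclotomic → ClassicalMuVanishes κE)
    (hμD : ∀ κE : ZpExtension ↥(fixedField (Subgroup.zpowers (absRestrictNormalHom (W.divisionField 5) σu *
        absRestrictNormalHom (W.divisionField 5) σu * absRestrictNormalHom (W.divisionField 5) σv))) 5,
      κE.IsCyclotomic → ClassicalMuVanishes κE)
    (hμX : ∀ κE : ZpExtension ↥(fixedField (Subgroup.zpowers (absRestrictNormalHom (W.divisionField 5) σu *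
        absRestrictNormalHom (W.divisionField 5) σu) ⊔ Subgroup.zpowers (absRestrictNormalHom (W.divisionField 5) σv))) 5,
      κE.IsCyclotomic → ClassicalMuVanishes κE)
    (hμC : ∀ κE : ZpExtension ↥(fixedField (Subgroup.zpowers (absRestrictNormalHom (W.divisionField 5) σu *
        absRestrictNormalHom (W.divisionField 5) σv) ⊔ Subgroup.zpowers (absRestrictNormalHom (W.divisionField 5) σw))) 5,
      κE.IsCyclotomic → ClassicalMuVanishes κE) :
    MissingUpperBoundAt W 5 := by
  subst hWeq
  haveI : Fact (Nat.Prime 5) := ⟨by norm_num⟩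
  exact CartanMuRoadDoorsTprimeFive.missingUpperBoundAt_five_tame_of_splitCartanBasis_of_mu _ hKatoA hGZK hmod hCS hFW hr
    addv_g283200dw1_5 subTprime_g283200dw1_5 irr_g283200dw1_5
    e he σu σv σw hσu hσv hσw hμP hμD hμX hμC

/-! ### `283200gf1` @ `p = 5` — `N = 283200 = 2^6·3·5^2·59`; Cremona: `r_an = 0`; (t′) at `5`: `e = 3` (Kodaira IV or IV*);
mod-`5` image the normaliser of a SPLIT Cartan `N_s(5)` (LMFDB `5Ns`; #G 32 N_s(5)-type: v order 4 with L^<v> ~ Q(P), z central of order 4, u = z v^-1 = w v w^-1 (w involution) checked); ♯ row with TWO Tamagawa carriers (`5 ∣ c_q` at two multiplicative `q`): the `p = 5` Conj-A RESIDUE row of 19916 — no unit-twist road; no unit-twist record through census v13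
(`ellrank`-exhausted; kernel lemmas in THIS file). Leaf census (kit j309300, conjA-anchor g12 engine `unitidx.gp` v2.1 sha16 0eb8f6c644f9c1fa with
the `N_s(5)` roles of g11's road R5; class numbers CERTIFIED by `bnfcertify`): P<v> deg 8 `x^8 + 20*x^4 + 40*x^2 + 20` h = 4 (CERT) primes above 5 [[8, 1]] ⇒ PASS:IW56; Dq<u^2 v> deg 8 `x^8 + 20*x^4 - 40*x^2 + 20` h = 4 (CERT) primes above 5 [[8, 1]] ⇒ PASS:IW56; X<u^2,v> deg 4 `x^4 - 2*x^3 + 4*x^2 + 2*x + 1` h = 4 (CERT) primes above 5 [[4, 1]] ⇒ PASS:IW56; C<uv,w> deg 4 `x^4 - x^2 - 1` h = 1 (CERT) primes above 5 [[2, 2]] ⇒ PASS:IW56 ⇒ `CHAIN:PASS` — every leaf by Iwasawa 1956 (one prime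
above 5, `5 ∤ h`; a tree theorem). -/

/-- `[0, 1, 0, 194792, (-94585162)]` (Cremona's minimal model of `283200gf1`, `N = 283200 = 2^6·3·5^2·59`) is an elliptic curve: `|Δ| = 2^6·3^5·5^8·59^5 ≠ 0`. [cite: Cremona2006, Table 1 (Cremona label 283200gf1)] -/
theorem isElliptic_g283200gf1 : (⟨0, 1, 0, 194792, (-94585162)⟩ : WeierstrassCurve ℚ).IsElliptic :=
  isElliptic_of_discOf_ne_zero 0 1 0 194792 (-94585162) (by decide +kernel)

/-- `[0, 1, 0, 194792, (-94585162)]` (Cremona's minimal model of `283200gf1`) is globally minimal: `|Δ| = 2^6·3^5·5^8·59^5` kernel-checked, Kraus' criterion prime by prime.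
[cite: SilvermanAEC2009, VII.1 Remark 1.1] [cite: Kraus1989, Prop. 1 and Prop. 2] [cite: Cremona2006, Table 1 (Cremona label 283200gf1)] -/
theorem isGloballyMinimal_g283200gf1 : (⟨0, 1, 0, 194792, (-94585162)⟩ : WeierstrassCurve ℚ).IsGloballyMinimal :=
  isGloballyMinimal_of_krausCriterion₃_factored 0 1 0 194792 (-94585162)
    [(2, 6), (3, 5), (5, 8), (59, 5)] (by decide +kernel)
    (by intro qe hqe; simp only [List.mem_cons, List.not_mem_nil, or_false] at hqe
        rcases hqe with rfl | rfl | rfl | rfl <;> norm_num)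
    (by set_option synthInstance.maxSize 2000 in decide +kernel)

/-- **`E[5]` IRREDUCIBLE for `E = 283200gf1`** (kernel; Frobenius witness `ℓ = 13`: `#Ẽ(𝔽_{13}) = 14`, `a_{13} = 0`, `X² − (0)X + 13`
has no root mod `5`; `IntModel.hasIrreducibleModPGaloisRep_of_intModel_of_noroot`). [cite: Mazur1978, §6 Prop. 6.3 (1) (p. 153)]
[cite: IrelandRosen1990, Prop. 5.1.2 and §8.1] [cite: Cremona2006, Table 1 (Cremona label 283200gf1)] -/
theorem irr_g283200gf1_5 : haveI : Fact (Nat.Prime 5) := ⟨by norm_num⟩; (⟨0, 1, 0, 194792, (-94585162)⟩ : WeierstrassCurve ℚ).HasIrreducibleModPGaloisRep 5 := by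
  have hnr : ∀ t : ZMod 5, t ^ 2 - ((((13 : ℕ) : ℤ) + 1 - ((14 : ℕ) : ℤ) : ℤ) : ZMod 5) * t + ((13 : ℕ) : ZMod 5) ≠ 0 := by
    decide
  haveI := isElliptic_g283200gf1
  haveI := isGloballyMinimal_g283200gf1
  haveI : Fact (Nat.Prime 5) := ⟨by norm_num⟩
  haveI : Fact (Nat.Prime 13) := ⟨by norm_num⟩
  have hI : integralModelInt (⟨0, 1, 0, 194792, (-94585162)⟩ : WeierstrassCurve ℚ) = (⟨0, 1, 0, 194792, (-94585162)⟩ : WeierstrassCurve ℤ) :=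
    integralModelInt_eq_of_map_eq _ (map_mk_int 0 1 0 194792 (-94585162))
  have hc : Nat.card (((((⟨0, 1, 0, 194792, (-94585162)⟩ : WeierstrassCurve ℤ))).map (Int.castRingHom (ZMod 13))).toAffine.Point) = 14 := by
    have h := natCard_point_eq_countPoints 0 1 0 194792 (-94585162) 13 (by norm_num) (by decide +kernel)
    have h' : countPoints [0, 1, 0, 194792, (-94585162)] 13 = 14 := countPoints_eq_of_fast (by decide +kernel)
    exact_mod_cast h.trans h'
  exact hasIrreducibleModPGaloisRep_of_intModel_of_noroot hI 5 13 (by norm_num) (by decide +kernel) hc hnr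

/-- **`283200gf1` is ADDITIVE at `5`** (kernel: `5 ∣ Δ`, `5 ∣ c₄` on the minimal model; `Additive.addv_of_intModel`).
[cite: SilvermanAEC2009, VII.5 Prop. 5.1 (c)] [cite: Cremona2006, Table 1 (Cremona label 283200gf1)] -/
theorem addv_g283200gf1_5 : haveI := isElliptic_g283200gf1; haveI := isGloballyMinimal_g283200gf1; haveI : Fact (Nat.Prime 5) := ⟨by norm_num⟩; Addv (⟨0, 1, 0, 194792, (-94585162)⟩ : WeierstrassCurve ℚ) 5 := by
  haveI := isElliptic_g283200gf1
  haveI := isGloballyMinimal_g283200gf1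
  haveI : Fact (Nat.Prime 5) := ⟨by norm_num⟩
  have hI : integralModelInt (⟨0, 1, 0, 194792, (-94585162)⟩ : WeierstrassCurve ℚ) = (⟨0, 1, 0, 194792, (-94585162)⟩ : WeierstrassCurve ℤ) :=
    integralModelInt_eq_of_map_eq _ (map_mk_int 0 1 0 194792 (-94585162))
  exact Additive.addv_of_intModel hI 5 (by decide +kernel) (by decide +kernel)

/-- **`ord_5 j(E) ≥ 0` for `E = 283200gf1`** (kernel: `5^5 ∣ c₄`, `5^9 ∤ Δ`, `8 ≤ 3·5` on the minimal model;
`padicValRat_j_nonneg_of_intModel`) — potentially good reduction at `5`. [cite: SilvermanAEC2009, VII.5 Prop. 5.5] [cite: Cremona2006, Table 1 (Cremona label 283200gf1)] -/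
theorem jint_g283200gf1_5 : haveI := isElliptic_g283200gf1; 0 ≤ padicValRat 5 (⟨0, 1, 0, 194792, (-94585162)⟩ : WeierstrassCurve ℚ).j := by
  haveI := isElliptic_g283200gf1
  haveI := isGloballyMinimal_g283200gf1
  haveI : Fact (Nat.Prime 5) := ⟨by norm_num⟩
  have hI : integralModelInt (⟨0, 1, 0, 194792, (-94585162)⟩ : WeierstrassCurve ℚ) = (⟨0, 1, 0, 194792, (-94585162)⟩ : WeierstrassCurve ℤ) :=
    integralModelInt_eq_of_map_eq _ (map_mk_int 0 1 0 194792 (-94585162))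
  exact TameUpperUnitTwistRecords.padicValRat_j_nonneg_of_intModel hI 5 (a := 5) (b := 8) (by decide +kernel) (by decide +kernel) (by norm_num)

/-- **`283200gf1` lies on the census cell (t′) at `p = 5`** (kernel: `SubTprime` = not potentially multiplicative (`jint_g283200gf1_5`),
`f_5 = 2` (automatic at an additive `p ≥ 5`), semistability index `e = 12/gcd(12, ord_5 Δ) = 12/gcd(12,8) = 3 ∤ 5 − 1`;
`subTprime_of_intModel`). [cite: SilvermanATAEC1994, IV.10.4] [cite: Delbourgo1998, §1.5] [cite: Cremona2006, Table 1 (Cremona label 283200gf1)] -/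
theorem subTprime_g283200gf1_5 : haveI := isElliptic_g283200gf1; haveI := isGloballyMinimal_g283200gf1; haveI : Fact (Nat.Prime 5) := ⟨by norm_num⟩; SubTprime (⟨0, 1, 0, 194792, (-94585162)⟩ : WeierstrassCurve ℚ) 5 := by
  haveI := isElliptic_g283200gf1
  haveI := isGloballyMinimal_g283200gf1
  haveI : Fact (Nat.Prime 5) := ⟨by norm_num⟩
  have hI : integralModelInt (⟨0, 1, 0, 194792, (-94585162)⟩ : WeierstrassCurve ℚ) = (⟨0, 1, 0, 194792, (-94585162)⟩ : WeierstrassCurve ℤ) :=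
    integralModelInt_eq_of_map_eq _ (map_mk_int 0 1 0 194792 (-94585162))
  exact TameUpperUnitTwistRecords.subTprime_of_intModel hI 5 (by norm_num) addv_g283200gf1_5 jint_g283200gf1_5 (b := 8) (by decide +kernel) (by decide +kernel)
    (by decide)

/-- **(A) at `(283200gf1, 5)` — the conclusion of `TameCoatesSujathaResidue` (19916) AT THIS ROW**, by conjA-anchor g11's split-Cartan road
R2–R5 (`CoatesSujatha2005.fineSelmerDual_moduleFinite_of_splitCartanBasis_five`, p624652): for every cyclotomic `ℤ_5`-extension `κ` of `ℚ`, the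
dual fine Selmer group of `E` over `ℚ_cyc` is finitely generated over `ℤ_5`, from the NAMED FACTS `hCS` (Coates–Sujatha Thm. 3.4) and `hFW`
(Ferrero–Washington), the DISPLAYED split-Cartan basis data (`e`, `he`, `σ_u ↦ diag(2,1)`, `σ_v ↦ diag(1,2)`, `σ_w ↦ (0 1;1 0)`) and `μ = 0` for
the cyclotomic `ℤ_5`-extension of the FOUR fixed fields `ℚ(P₁)` (8), `ℚ(E[5])^⟨σ̄_u²σ̄_v⟩` (8), `ℚ(x P₁)` (4), `ℚ(⟨P₁+P₂⟩)` (4)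
(`hμP hμD hμX hμC`; numerically the leaves `P<v>`, `Dq<u^2 v>`, `X<u^2,v>`, `C<uv,w>` of the section header, all `PASS:IW56`, certified).
CONDITIONAL record; (A) is asserted for no curve; nothing booked. [cite: CoatesSujatha2005, Thm. 3.4 (§3)] [cite: Washington1997, §7.5, §13.1]
[cite: Serre1972, §2.2] [cite: Lemmermeyer1994, §1] [cite: Cremona2006, Table 1 (Cremona label 283200gf1)] -/
theorem conjA_g283200gf1_5
    (hCS : CoatesSujatha2005.thm34_fineSelmerDual_moduleFinite_of_classicalMuVanishes_divisionField)
    (hFW : ferreroWashington1979_classicalMuVanishes)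
    {W : WeierstrassCurve ℚ} [W.IsElliptic] (hWeq : W = (⟨0, 1, 0, 194792, (-94585162)⟩ : WeierstrassCurve ℚ))
    (e : W.geomTorsion (5 : ℕ) ≃+ (Fin 2 → ZMod 5))
    (he : ∀ σ : absoluteGaloisGroup ℚ, ∃ M ∈ splitCartanNormalizer 5, ∀ P : W.geomTorsion (5 : ℕ), e (σ • P) = M *ᵥ e P)
    (σu σv σw : absoluteGaloisGroup ℚ) (hσu : ∀ P : W.geomTorsion (5 : ℕ), e (σu • P) = !![2, 0; 0, 1] *ᵥ e P)
    (hσv : ∀ P : W.geomTorsion (5 : ℕ), e (σv • P) = !![1, 0; 0, 2] *ᵥ e P)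
    (hσw : ∀ P : W.geomTorsion (5 : ℕ), e (σw • P) = !![0, 1; 1, 0] *ᵥ e P)
    (hμP : ∀ κE : ZpExtension ↥(fixedField (Subgroup.zpowers (absRestrictNormalHom (W.divisionField 5) σv))) 5,
      κE.IsCyclotomic → ClassicalMuVanishes κE)
    (hμD : ∀ κE : ZpExtension ↥(fixedField (Subgroup.zpowers (absRestrictNormalHom (W.divisionField 5) σu *
        absRestrictNormalHom (W.divisionField 5) σu * absRestrictNormalHom (W.divisionField 5) σv))) 5,
      κE.IsCyclotomic → ClassicalMuVanishes κE)
    (hμX : ∀ κE : ZpExtension ↥(fixedField (Subgroup.zpowers (absRestrictNormalHom (W.divisionField 5) σu *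
        absRestrictNormalHom (W.divisionField 5) σu) ⊔ Subgroup.zpowers (absRestrictNormalHom (W.divisionField 5) σv))) 5,
      κE.IsCyclotomic → ClassicalMuVanishes κE)
    (hμC : ∀ κE : ZpExtension ↥(fixedField (Subgroup.zpowers (absRestrictNormalHom (W.divisionField 5) σu *
        absRestrictNormalHom (W.divisionField 5) σv) ⊔ Subgroup.zpowers (absRestrictNormalHom (W.divisionField 5) σw))) 5,
      κE.IsCyclotomic → ClassicalMuVanishes κE)
    (κ : ZpExtension ℚ 5) (hκ : κ.IsCyclotomic) :
    ∃ (γ : absoluteGaloisGroup ℚ) (Df : W.FineSelmerDualData κ γ),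
      Module.Finite ℤ_[5] (RestrictScalars ℤ_[5] (IwasawaAlgebra 5) Df.X) := by
  subst hWeq
  haveI : Fact (Nat.Prime 5) := ⟨by norm_num⟩
  exact CoatesSujatha2005.fineSelmerDual_moduleFinite_of_splitCartanBasis_five hCS hFW _ e he σu σv σw hσu hσv hσw hμP hμD hμX hμC κ hκ

/-- **RECORD — UPPER half `ord₅ #Ш(E) ≤ ord₅ #Ш(E)_an` for `E = 283200gf1` at `p = 5` BY THE μ-ROAD** (U₀-ns row of KT items 19202 /
19982; the FIRST road of any kind for this row: with two Tamagawa carriers neither unit-twist road applies (k8t-c4 g14 §3(b)), while Kato’s bound keeps the Tamagawa term on the correct side and needs no carrier hypothesis): the (t′) door `CartanMuRoadDoorsTprimeFive.missingUpperBoundAt_five_tame_of_splitCartanBasis_of_mu` (fine-Selmer port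
of Kato 14.5 (3) ∘ (A) from the four `μ`-hypotheses). KERNEL (this file): `Δ ≠ 0`, global minimality (Kraus), `E[5]` irreducible (Frobenius
witness), `Addv E 5`, `ord₅ j ≥ 0`, `SubTprime E 5`. DISPLAYED: the named facts `hKatoA hGZK hmod hCS hFW`; Cremona's `r_an = 0` (`hr`); the
split-Cartan basis data and the four `μ`-hypotheses of `conjA_g283200gf1_5`. Per row; CONDITIONAL; nothing booked; BSD is not proved by this.
[cite: Kato2004Asterisque, Thm. 14.5 (3) (p. 236), Thm. 12.5 (3) (p. 222)] [cite: CoatesSujatha2005, Thm. 3.4 (§3)] [cite: Washington1997, §13.1]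
[cite: Miller2011LMS, Def. 1.1] [cite: Cremona2006, Table 1 (Cremona label 283200gf1)] -/
theorem missingUpperBoundAt_g283200gf1_5
    (hKatoA : Kato2004.rankZero_padicValNat_sha_add_padicValNat_tamagawa_le_of_additive_potGood_of_irreducible_of_fineSelmerDual_fg)
    (hGZK : rank_eq_analyticRank_of_analyticRank_le_one) (hmod : hasEntireLFunction_rat)
    (hCS : CoatesSujatha2005.thm34_fineSelmerDual_moduleFinite_of_classicalMuVanishes_divisionField)
    (hFW : ferreroWashington1979_classicalMuVanishes)
    {W : WeierstrassCurve ℚ} [W.IsElliptic] [W.IsGloballyMinimal] (hWeq : W = (⟨0, 1, 0, 194792, (-94585162)⟩ : WeierstrassCurve ℚ)) (hr : W.analyticRank = 0)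
    (e : W.geomTorsion (5 : ℕ) ≃+ (Fin 2 → ZMod 5))
    (he : ∀ σ : absoluteGaloisGroup ℚ, ∃ M ∈ splitCartanNormalizer 5, ∀ P : W.geomTorsion (5 : ℕ), e (σ • P) = M *ᵥ e P)
    (σu σv σw : absoluteGaloisGroup ℚ) (hσu : ∀ P : W.geomTorsion (5 : ℕ), e (σu • P) = !![2, 0; 0, 1] *ᵥ e P)
    (hσv : ∀ P : W.geomTorsion (5 : ℕ), e (σv • P) = !![1, 0; 0, 2] *ᵥ e P)
    (hσw : ∀ P : W.geomTorsion (5 : ℕ), e (σw • P) = !![0, 1; 1, 0] *ᵥ e P)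
    (hμP : ∀ κE : ZpExtension ↥(fixedField (Subgroup.zpowers (absRestrictNormalHom (W.divisionField 5) σv))) 5,
      κE.IsCyclotomic → ClassicalMuVanishes κE)
    (hμD : ∀ κE : ZpExtension ↥(fixedField (Subgroup.zpowers (absRestrictNormalHom (W.divisionField 5) σu *
        absRestrictNormalHom (W.divisionField 5) σu * absRestrictNormalHom (W.divisionField 5) σv))) 5,
      κE.IsCyclotomic → ClassicalMuVanishes κE)
    (hμX : ∀ κE : ZpExtension ↥(fixedField (Subgroup.zpowers (absRestrictNormalHom (W.divisionField 5) σu *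
        absRestrictNormalHom (W.divisionField 5) σu) ⊔ Subgroup.zpowers (absRestrictNormalHom (W.divisionField 5) σv))) 5,
      κE.IsCyclotomic → ClassicalMuVanishes κE)
    (hμC : ∀ κE : ZpExtension ↥(fixedField (Subgroup.zpowers (absRestrictNormalHom (W.divisionField 5) σu *
        absRestrictNormalHom (W.divisionField 5) σv) ⊔ Subgroup.zpowers (absRestrictNormalHom (W.divisionField 5) σw))) 5,
      κE.IsCyclotomic → ClassicalMuVanishes κE) :
    MissingUpperBoundAt W 5 := by
  subst hWeq
  haveI : Fact (Nat.Prime 5) := ⟨by norm_num⟩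
  exact CartanMuRoadDoorsTprimeFive.missingUpperBoundAt_five_tame_of_splitCartanBasis_of_mu _ hKatoA hGZK hmod hCS hFW hr
    addv_g283200gf1_5 subTprime_g283200gf1_5 irr_g283200gf1_5
    e he σu σv σw hσu hσv hσw hμP hμD hμX hμC

end Summit.BirchSwinnertonDyer.BirchSwinnertonDyer.Theorems.TameConjAFiveRecords

end
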